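import Summits.BirchSwinnertonDyer.BirchSwinnertonDyer.Theorems.ClassRecordThreeEulerHalvesAtThreeWalkSupplyCarrier
import Summits.BirchSwinnertonDyer.BirchSwinnertonDyer.Theorems.Rank1ResidualJetKolyvaginClassLocal
import Literature.NumberTheory.EllipticCurves.HeegnerPointsOfConductorRationalityProofs
import Literature.NumberTheory.EllipticCurves.RingClassGalOverCyclicProofs
import HarnessLib

/-!
# The walk's CARRIER PACKAGE: the family `𝒮` at the carrier pair `{v₀, τ • v₀}` with (δ) of order
# `p ^ ord_p c_v(E)` AND the membership of the Kolyvagin classes in `𝒮` there — stringent carrier when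
# `p ∣ c_v(E)` (membership = bsd-jet's gap `h49str`), Kummer carrier otherwise (membership = Gross
# Prop. 6.2 (1) from [GZ86 III (3.1)]) (cell `bsd-stepL`, seat `bsd-stepL-tam3-p1`, helper toward item
# 19109 `EulerHalvesAtThree`, registered stub `stub_supplyAtThree`)

HONEST FRAMING. Nothing here proves BSD, J₃ or any divisibility of a Heegner point; no stub is
discharged; no item closes; 0 classes move (T7); `--supports stmt-BirchSwinnertonDyer-19109` (helper).

WHAT THIS FILE DOES. `exists_carrierPackage`: for the stub's place `v` of `ℚ` and level `p^k ≥
p^{ord_p c_v}`, a family `𝒮 ≤ Kum`, a place `v₀` moved by `τ` with `N ∈ v₀, τ • v₀`, `𝒮` `τ`-stable at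
the pair, (δ) `Kum_{v₀}/𝒮_{v₀}` cyclic of order `p ^ ord_p c_v(E)`, and: for every admissible `c`,
Kolyvagin `ℓ ∤ c` of index `≥ k` and datum `d'` at `cℓ`, `loc_q c_k(cℓ) ∈ 𝒮_q` at both carrier places
— by cases: `ord_p c_v ≥ 1` ⇒ `…WalkSupplyCarrier.exists_stringentCarrier` + the stringent membership
HYPOTHESIS (`h49str`, specialised to the frame); `ord_p c_v = 0` ⇒ `exists_kummerCarrier` over a prime
`p ∣ N` + `JET.localization_kolyvaginClass_mem_kummerSelmerStructure_of_GZ31` (the carrier place holds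
`N`, hence no Kolyvagin prime). These are the inputs `𝒮, hS, v₀, hv₀, hv₀N, h𝒮σ, hcyc, hidx` of
`Walk.exists_dualityConjuncts_of_localFacts` and the carrier clause of the supply's `hsel0`.
References (locators only; no cited FACT is declared): [cite: Jetchev2008, Lemma 3.2, Prop. 4.9, (δ)
(pp. 814–822)] [cite: GrossLMS1991, §6 Prop. 6.2 (1)] [cite: GrossZagier1986, III (3.1)]
[cite: WZhang2014, Notations (xii)]. Design: one theorem, no definitions; `K : Type`. Axioms:
`propext`, `Classical.choice`, `Quot.sound`.
-/

set_option autoImplicit false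

noncomputable section

open scoped Classical Pointwise
open Function NumberField IsDedekindDomain WeierstrassCurve Field
open Literature.NumberTheory.EllipticCurves Literature.NumberTheory.GaloisRepresentations
open Literature.NumberTheory.EllipticCurves.Jetchev2008 Literature.NumberTheory.EllipticCurves.ModularForms
open Literature.NumberTheory.GaloisCohomology Literature.NumberTheory.Automorphic
open Literature.NumberTheory.GaloisRepresentations.DiscreteGaloisModule (SelmerStructure)
open Summit.BirchSwinnertonDyer.Rank1Residual.JET.SelmerVocabulary
open Summit.BirchSwinnertonDyer.Rank1Residual.X11b

namespace Summit.BirchSwinnertonDyer.Rank1Residual.JET.Walk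

variable (W : WeierstrassCurve ℚ) [W.IsElliptic] [W.IsGloballyMinimal] [NeZero (W.conductorNorm ℤ)]
  (K : Type) [Field K] [NumberField K]

/-- **The carrier package** (see the module docstring): `𝒮`, the split carrier place `v₀`, (δ) of
order `p ^ ord_p c_v(E)`, and the membership of `c_k(cℓ)` in `𝒮` at the carrier pair.
[cite: Jetchev2008, Lemma 3.2, Prop. 4.9, (δ) (pp. 814–822)] [cite: GrossLMS1991, §6 Prop. 6.2 (1)]
[cite: GrossZagier1986, III (3.1)] -/
theorem exists_carrierPackage (hK : IsImaginaryQuadratic K)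
    (hD3 : NumberField.discr K ≠ -3) (hD4 : NumberField.discr K ≠ -4) (τ : K ≃ₐ[ℚ] K) (hτ : τ ≠ 1)
    (hHN : SatisfiesHeegnerHypothesis (W.conductorNorm ℤ) K) (p : ℕ) [Fact p.Prime] (hp2 : p ≠ 2)
    (hpN : p ∣ W.conductorNorm ℤ) (hρ : W.HasSurjectiveModNGaloisRep p)
    (Dt : ModularParametrizationData W (W.conductorNorm ℤ)) (β : ℤ) (ι : K →+* ℂ)
    [∀ j : ℕ, NumberField (ringClassField K ι j)]
    {n' : ℤ} (hcop' : IsCoprime (p : ℤ) n')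
    (hGZ' : ∀ (m : ℕ) (dm : KolyvaginHeegnerData Dt β ι m)
      (γ : ringClassField K ι m ≃ₐ[ℚ] ringClassField K ι m), γ ∈ ringClassGal ι m →
      ∀ v : HeightOneSpectrum (𝓞 K), ¬ (W.baseChange K).HasGoodReductionAt v →
        n' • pointsMap (W.baseChange K) (v.adicCompletion K)
            (dm.toGeomPoints (pointGalHom W (ringClassField K ι m) γ dm.y)) ∈
          E0Receptacle (W.baseChange K) v ∧
        ∀ (ℓ : ℕ), ℓ ∈ m.primeFactors → ∀ (dm' : KolyvaginHeegnerData Dt β ι (m / ℓ))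
          (hle : ringClassField K ι (m / ℓ) ≤ ringClassField K ι m),
          n' • pointsMap (W.baseChange K) (v.adicCompletion K)
              (dm.toGeomPoints (pointGalHom W (ringClassField K ι m) γ
                (WeierstrassCurve.Affine.Point.map (W' := W)
                  ((RingClassField.inclusion ι hle).restrictScalars ℚ) dm'.y))) ∈
            E0Receptacle (W.baseChange K) v)
    (hΦ : ∀ (W : WeierstrassCurve ℚ) [W.IsElliptic] [W.IsGloballyMinimal] (ℓ p : ℕ) [Fact ℓ.Prime]
      [Fact p.Prime], p ≠ 2 → p ∣ (W.baseChange ℚ_[ℓ]).localTamagawaNumber ℤ_[ℓ] →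
      ∀ [(W.baseChange ℚ_[ℓ]).IsMinimal ℤ_[ℓ]],
      IsAddCyclic ((W.baseChange ℚ_[ℓ]).toAffine.Point ⧸ (W.baseChange ℚ_[ℓ]).goodReductionSubgroup ℤ_[ℓ]))
    (v : HeightOneSpectrum (𝓞 ℚ)) (k : ℕ) (hn : ((p ^ k : ℕ) : ℤ) ≠ 0)
    (htk : padicValNat p (W.tamagawaNumberAt v) ≤ k)
    (h49str : ∀ (c : ℕ), Squarefree c →
        (∀ ℓ ∈ c.primeFactors, Zhang2014.IsKolyvaginPrime (W.conductorNorm ℤ) W K p ℓ ∧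
          k ≤ Zhang2014.kolyvaginIndex W p ℓ) →
      ∀ (q : HeightOneSpectrum (𝓞 K)), ((W.conductorNorm ℤ : ℕ) : 𝓞 K) ∈ q.asIdeal →
      ∀ (ℓ : ℕ), Zhang2014.IsKolyvaginPrime (W.conductorNorm ℤ) W K p ℓ →
        k ≤ Zhang2014.kolyvaginIndex W p ℓ → ℓ ∉ c.primeFactors →
      ∀ (d' : KolyvaginHeegnerData Dt β ι (c * ℓ)),
        galoisCohomology.localization ((W.baseChange K).torsionGaloisModule ((p ^ k : ℕ) : ℤ))
            (Sum.inr q) 1 (d'.kolyvaginClass (Fact.out : p.Prime) k) ∈ stringentFamily W K hn (Sum.inr q)) :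
    ∃ (𝒮 : SelmerStructure ((W.baseChange K).torsionGaloisModule ((p ^ k : ℕ) : ℤ)))
      (v₀ : HeightOneSpectrum (𝓞 K)),
      (∀ w, 𝒮 w ≤ (W.baseChange K).kummerSelmerStructure ((p ^ k : ℕ) : ℤ) w) ∧
      τ • v₀ ≠ v₀ ∧ ((W.conductorNorm ℤ : ℕ) : 𝓞 K) ∈ v₀.asIdeal ∧
      ((W.conductorNorm ℤ : ℕ) : 𝓞 K) ∈ (τ • v₀).asIdeal ∧
      (∀ (v w : HeightOneSpectrum (𝓞 K)) (h : τ • v = w), v ∈ ({v₀, τ • v₀} : Finset _) →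
        ∀ x : galoisCohomology (((W.baseChange K).torsionGaloisModule ((p ^ k : ℕ) : ℤ)).toLocal
          (Sum.inr v : Place K)) 1,
        x ∈ 𝒮 (Sum.inr v) → conjActPlace W τ ((p ^ k : ℕ) : ℤ) h x ∈ 𝒮 (Sum.inr w)) ∧
      IsAddCyclic (↥((W.baseChange K).kummerSelmerStructure ((p ^ k : ℕ) : ℤ) (Sum.inr v₀)) ⧸
        (𝒮 (Sum.inr v₀)).addSubgroupOf
          ((W.baseChange K).kummerSelmerStructure ((p ^ k : ℕ) : ℤ) (Sum.inr v₀))) ∧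
      (𝒮 (Sum.inr v₀)).relIndex ((W.baseChange K).kummerSelmerStructure ((p ^ k : ℕ) : ℤ) (Sum.inr v₀)) =
        p ^ padicValNat p (W.tamagawaNumberAt v) ∧
      (∀ q ∈ ({v₀, τ • v₀} : Finset (HeightOneSpectrum (𝓞 K))),
        ∀ (c : ℕ), Squarefree c →
        (∀ ℓ ∈ c.primeFactors, Zhang2014.IsKolyvaginPrime (W.conductorNorm ℤ) W K p ℓ ∧
          k ≤ Zhang2014.kolyvaginIndex W p ℓ) →
        ∀ (ℓ : ℕ), Zhang2014.IsKolyvaginPrime (W.conductorNorm ℤ) W K p ℓ →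
          k ≤ Zhang2014.kolyvaginIndex W p ℓ → ℓ ∉ c.primeFactors →
        ∀ (d' : KolyvaginHeegnerData Dt β ι (c * ℓ)),
          galoisCohomology.localization ((W.baseChange K).torsionGaloisModule ((p ^ k : ℕ) : ℤ))
            (Sum.inr q) 1 (d'.kolyvaginClass (Fact.out : p.Prime) k) ∈ 𝒮 (Sum.inr q)) := by
  by_cases ht : 1 ≤ padicValNat p (W.tamagawaNumberAt v)
  · -- the stringent carrier over the prime under `v`
    obtain ⟨v₀, hv₀, hv₀N, hv₀N', hS, h𝒮σ, hcyc, hidx⟩ :=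
      exists_stringentCarrier W K hK τ hτ hHN p hp2 hΦ v ht k hn htk
    refine ⟨stringentFamily W K hn, v₀, hS, hv₀, hv₀N, hv₀N', h𝒮σ, hcyc, hidx, ?_⟩
    intro q hq c hc hcK ℓ hℓK hkℓ hℓc d'
    have hqN : ((W.conductorNorm ℤ : ℕ) : 𝓞 K) ∈ q.asIdeal := by
      simp only [Finset.mem_insert, Finset.mem_singleton] at hq
      rcases hq with rfl | rfl
      · exact hv₀N
      · exact hv₀N'
    exact h49str c hc hcK q hqN ℓ hℓK hkℓ hℓc d'
  · -- the degenerate Kummer carrier over `3 ∣ N`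
    have ht0 : padicValNat p (W.tamagawaNumberAt v) = 0 := by omega
    obtain ⟨v₀, hv₀, hv₀N, hv₀N', hS, h𝒮σ, hcyc, hidx⟩ :=
      exists_kummerCarrier W K hK τ hτ hHN p hpN p k
    refine ⟨(W.baseChange K).kummerSelmerStructure ((p ^ k : ℕ) : ℤ), v₀, hS, hv₀, hv₀N, hv₀N', h𝒮σ,
      hcyc, by rw [hidx, ht0], ?_⟩
    intro q hq c hc hcK ℓ hℓK hkℓ hℓc d'
    have hqN : ((W.conductorNorm ℤ : ℕ) : 𝓞 K) ∈ q.asIdeal := by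
      simp only [Finset.mem_insert, Finset.mem_singleton] at hq
      rcases hq with rfl | rfl
      · exact hv₀N
      · exact hv₀N'
    -- the carrier place is not over a prime of `cℓ` (Kolyvagin primes are prime to `N`)
    have hℓ : ℓ.Prime := hℓK.1
    have hc0 : c ≠ 0 := hc.ne_zero
    have hcl : Squarefree (c * ℓ) :=
      (Nat.squarefree_mul ((Nat.Prime.coprime_iff_not_dvd hℓ).mpr fun h ↦
        hℓc (Nat.mem_primeFactors.mpr ⟨hℓ, h, hc0⟩)).symm).mpr ⟨hc, hℓ.squarefree⟩
    have hpf : (c * ℓ).primeFactors = c.primeFactors ∪ {ℓ} := by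
      rw [Nat.primeFactors_mul hc0 hℓ.ne_zero, hℓ.primeFactors]
    have hclK : ∀ l' ∈ (c * ℓ).primeFactors, Zhang2014.IsKolyvaginPrime (W.conductorNorm ℤ) W K p l' ∧
        k ≤ Zhang2014.kolyvaginIndex W p l' := by
      intro l' hl'
      rw [hpf, Finset.mem_union, Finset.mem_singleton] at hl'
      rcases hl' with h | rfl
      · exact hcK l' h
      · exact ⟨hℓK, hkℓ⟩
    refine localization_kolyvaginClass_mem_kummerSelmerStructure_of_GZ31
      (phi_heegnerPointOfConductor_mem_range_map_ringClassField_holds (W.conductorNorm ℤ) W K)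
      (exists_generator_ringClassGalOver_holds (K := K)) hK hD3 hD4 hHN hp2 hρ Dt β ι hcop' hGZ' hcl
      hclK d' (Sum.inr q) fun l' hl' hPO ↦ ?_
    obtain ⟨q', hqq, hq'⟩ := hPO
    cases hqq
    have hcopN : Nat.Coprime l' (W.conductorNorm ℤ) :=
      (Nat.Prime.coprime_iff_not_dvd (hclK l' hl').1.1).mpr (hclK l' hl').1.2.1
    exact Literature.NumberTheory.NumberFields.Honda1971.natCast_notMem_of_coprime hcopN _ hq' hqN

end Summit.BirchSwinnertonDyer.Rank1Residual.JET.Walk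

end
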